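import Summits.BirchSwinnertonDyer.Rank1Residual.X11b.Three.BDPExistsFromPrint
import HarnessLib

/-!
# X11b @ `p = 3`, S24 'λ-SUPPLY SPLIT' (b)+(c): the ONE residual of S18 split as
# `(λ-supply) ∧ HsiehDescentAt₃ W ⟹ HsiehFrameResidualAt₃ W`

HONEST FRAMING (cell `b2b-bsdres`, run/shared/lean/b2b/bsd-rank1-residual/, verbatim in every
file): the goal of the cell is to DELETE the COMBINATION-SHAPED residual classes of the
Birch–Swinnerton-Dyer formula for ALL analytic-rank `≤ 1` elliptic curves over `ℚ` — assembled
STRICTLY from published theorems — so that the rank-`≤ 1` remainder becomes exactly the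
CONSTRUCTION-SHAPED classes, which are TYPED, NOT attempted. This is not "finishing BSD". Team N8/O2
(X11b at `3`: `3 ‖ N`, `r_an = 1`, `E[3]` irreducible): research route; nothing booked; NO label
changes; O2 stays OPEN. THEOREMS + ONE `@[conjecture]`-tagged named residual (an obligation node
stated in our theories — NOT a vendored fact, NOT asserted); no `sorry`.

PROVENANCE: sub-target S24 (OWNERS R7-59, lead x11b3 GEN 6; r1 GEN 5 LW-LSUP `LSUP-SKETCH.lean`
a967b5b6a0bd87a8; lit1 GEN 7 LIT-TABLE L58 'λ-SUPPLY SOURCED AT THE PAGE'), seat `b2b-bsdres-x11b3-p7`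
(gen. 4); feasibility census `HOME/b2b-bsdres-x11b3-p7/s24/S24-FEASIBILITY.md`; TYPING OF RECORD =
r1 GEN 6 FORM I (`HOME/b2b-bsdres-x11b3-r1/S24-SKETCH.lean` 338613c2ea07da51, note `S24-TYPING-r1.md`
57ed101dd568601f), r2 GEN 7 final cross-read PASS (10:15Z), lead R7-66 conditional GO.

## What this file does

S18(b) (`BDPExistsFromPrint.lean`) discharged H1 = `Three.BDPExistsAt₃ W` from Hsieh 2014, Thm. 1 up
to ONE named residual `Three.HsiehFrameResidualAt₃ W` = (λ) ∧ (t): over S22's datum, (λ) "an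
anticyclotomic Hecke character `λ` of `K` of infinity type `(1,−1)`, unitary, of `3`-power conductor,
whose `3`-adic avatar factors through the anticyclotomic `ℤ₃`-extension `κ` EXISTS", and (t) "every
Hsieh witness for `λ` admits an `R₀ = 𝒪(ℚ̂₃^ur)`-rational re-normalisation" (not in print at `3 ∣ N`).
The two conjuncts are of a different nature: (λ) is a THEOREM of class field theory (de Shalit 1987,
II.1.4 (ii); Cornut–Vatsal 2007, Cor. 2.2; Weil 1956; folklore — lit1 L58), provable in the tree with
fact debt `0` (census §1–§3; sub-target S24-a `Three.lambdaSupplyAt₃`, multi-cycle); (t) is the honest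
research residual. This file SPLITS them:

* **`HsiehDescentAt₃ W`** (`@[conjecture]`, S24-b; the ONE new named residual, typed by r1): the
  λ-FREE part (t) of `HsiehFrameResidualAt₃ W`, i.e. its inner `∀ (A, Ω_K, C, Ω_p, Q) …` under the
  residual's OWN datum binders VERBATIM. `IsHsiehLFunction` does not mention `λ`, so this is literally
  the second conjunct. NOTHING of it is asserted.
* **`hsiehFrameResidualAt₃_of_descent`** (S24-c): `(λ-supply) → HsiehDescentAt₃ W →
  HsiehFrameResidualAt₃ W` — two lines. Until S24-a lands as a theorem, λ-supply enters as the explicit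
  HYPOTHESIS `hsup` whose statement is S24-a VERBATIM (the six clauses = binders [08]–[13] of
  `hsieh2014_exists_anticyclotomicPAdicLFunction` at `p = 3`); no `def … : Prop` is introduced for it
  (D-0026; lit1 L58 (ii)).
* `hsiehDescentAt₃_of_hsiehFrameResidualAt₃` (the split is LOSSLESS) and the calibration
  `hsiehDescentAt₃_of_forall_exists_isBDPLFunction` (framewise H1 ⟹ S24-b, unconditionally: the
  residual did not grow).
* consumer corollaries `bdpExistsAt₃_of_hsieh2014_of_descent`,
  `bsdp_of_halves₃_onA1_of_hsieh2014_of_descent`, `missingInputAt_of_halves₃_onA1_of_hsieh2014_of_descent`: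
  S18(b)'s end theorems with `hres : HsiehFrameResidualAt₃ W` replaced by `(hsup, hdesc)`.

EFFECT OF RECORD when S24-a lands (wording only): H1's named residual at `3` SHRINKS from (λ) ∧ (t) to
(t) = `HsiehDescentAt₃ W`. `HsiehFrameResidualAt₃` itself is untouched and stays the assembly node
(R7-41 'one residual def' for S18; this is S24's one def). No mark moves.

## References

* [Hsieh2014] M.-L. Hsieh, Doc. Math. 19 (2014), Thm. 1 (arXiv:1112.1580 pp. 3–4), p. 3 ll. 28–31,
  p. 23 ll. 21–22 (the avatar dictionary; `λ` of `p`-power conductor).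
* [Castella2018] F. Castella, Camb. J. Math. 6 (2018), Thm. 3.1 and p. 9 l. 42 (arXiv:1704.06608)
  ("Let `ψ` be an anticyclotomic Hecke character of `K` of infinity type `(1,−1)` …").
* [CastellaHsieh2018] F. Castella, M.-L. Hsieh, Math. Ann. 370 (2018), Def. 3.5, Prop. 3.6.
* [deShalit1987] E. de Shalit, *Iwasawa theory of elliptic curves with complex multiplication*,
  Perspectives in Math. 3 (1987), II.1.4 Lemma (ii) (p. 35).
* [CornutVatsal2007] C. Cornut, V. Vatsal, in *L-functions and Galois representations* (2007),
  §2.1 Cor. 2.2 (p. 21).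
* Cell files: `cells/x11b3/OWNERS.md` R7-59; `LIT-TABLE.md` L58; r1 `LSUP-SKETCH.lean`.
-/

noncomputable section

open scoped Classical

open WeierstrassCurve NumberField IsDedekindDomain Field
  Literature.NumberTheory.EllipticCurves Literature.NumberTheory.EllipticCurves.GreenbergSelmer
  Literature.NumberTheory.EllipticCurves.ModularForms Literature.NumberTheory.EllipticCurves.Rank1Residual
  Literature.NumberTheory.EllipticCurves.Rank1Residual.Typed Literature.NumberTheory.EllipticCurves.Wuthrich2014
  Literature.NumberTheory.GaloisRepresentations Literature.NumberTheory.GaloisCohomology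
  Literature.NumberTheory.Automorphic
  Summit.BirchSwinnertonDyer.Rank1Residual.X11b.AcSelmer Summit.BirchSwinnertonDyer.Rank1Residual.X11b.LocBridge

namespace Summit.BirchSwinnertonDyer.Rank1Residual.X11b.Three

/-! ### S24-b: the λ-free residual `HsiehDescentAt₃ W` -/

section Residual

variable (W : WeierstrassCurve ℚ) [W.IsElliptic] [W.IsGloballyMinimal]

/-- **`HsiehDescentAt₃ W` — "every Hsieh witness is `R₀`-rational up to an admissible re-normalisation"**
(S24-b; hypothesis-shaped; the λ-FREE conjunct (t) = (t1)+(t2)+(t3) of `HsiehFrameResidualAt₃ W`, under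
that residual's own datum binders VERBATIM). Over the data of S22's assembly at `p = 3` — `ι' : ℚ̄₃ ≃ ℂ`,
S0's `K, 𝔭, κ, γ`, the newform `f ∈ S_2(Γ₀(N))` of `E` with `N = N_E`, `ClassX11b W 3`, `Surj W 3`, `K`
imaginary quadratic with `d_K` odd and the classical Heegner hypothesis for `N`, `3` split, `3 ∈ 𝔭` with
`e = f = 1`, `ι'` inducing `𝔭`, the (Heeg) clause, `κ` anticyclotomic with generator `γ` —: for EVERY
Hsieh witness `(A, Ω_K, C, Ω_p, Q)` (`0 < A`, `Ω_K ≠ 0`, `‖ι'⁻¹C‖ = 1`, `‖Ω_p‖ = 1`,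
`IsHsiehLFunction ι' 𝔭 κ γ f A Ω_K C Ω_p Q` — the conclusion of
`hsieh2014_exists_anticyclotomicPAdicLFunction` verbatim; it does not mention the auxiliary `λ`) there
is an `R₀`-frame `Ω_K' ≠ 0`, `Ω_p' ∈ R₀ˣ`, `L ∈ R₀⟦T⟧` taking at every unramified `χ` of tree type
`(n, −n)`, `n > 0`, with avatar `r` through `κ`, the value `ι'⁻¹(hsiehInterpolationValue 3 f 𝔭 χ n A Ω_K' 1) ·
Ω_p'^{4n}` at `T = r(γ) − 1` — i.e. "Hsieh's element `Q ∈ Z̄₃⟦Γ⁻⟧` [arXiv:1112.1580 p. 3 l. 28, p. 7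
l. 36], period `Ω_p ∈ Z̄₃^×` [p. 23 ll. 63–66] and unit `C(π,λ) ∈ Z̄_{(3)}^×` [p. 4 l. 18] are, up to the
admissible re-normalisation `(Ω_K, Ω_p, Q) ↦ (Ω_K', Ω_p', C⁻¹·Q·…)`, `R₀ = 𝒪(ℚ̂₃^ur)`-rational"
(printed only by Castella–Hsieh 2018 Def. 3.5 under `p ∤ N` and Castella 2018 Thm. 3.1 for `p ≥ 5`;
Hsieh's proof runs over `𝓦 = W(𝔽̄_p)[λ]` [p. 21 l. 30, p. 25 l. 7]). The pure DESCENT statement at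
`3 ∣ N` — road (A′) — NOT in print; TYPED, not attempted; nothing asserted. With the λ-supply theorem
of class field theory (S24-a) it implies `HsiehFrameResidualAt₃ W` (`hsiehFrameResidualAt₃_of_descent`),
and conversely the residual implies it outright (`hsiehDescentAt₃_of_hsiehFrameResidualAt₃`): the split
is LOSSLESS, the NET effect of S24 on the named residual is that exactly the (λ)-conjunct leaves it.
CALIBRATION (r1/r2): framewise H1 (S22's antecedent: a tree frame with `IsBDPLFunction` at every datum)
implies this statement UNCONDITIONALLY (`hsiehDescentAt₃_of_forall_exists_isBDPLFunction`, converse glue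
`hsiehDisplay_of_isBDPLFunction`; the Hsieh witness is used only through `0 < A`), and (Hsieh 2014 Thm. 1
∧ λ-supply ∧ this) implies framewise H1 (`bdpExistsAt₃_of_hsieh2014_of_descent` before its last S22
step): MODULO (fact ∧ λ-supply) it IS framewise H1 made CONSUMABLE FROM PRINT (a proof may use Hsieh's
`Q, Ω_p, C`), not a logically smaller target. TWO ROADS (docstring gloss of record, lit1 L59/L60, r1 §4,
R7-61/61′/64), by `k(K,3) := log₃ [Γ⁻ : κ(I_𝔭)]`: (A) `k = 0` (e.g. `3 ∤ h_K`): a λ with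
`r_λ(Γ_K) ⊂ 1 + 3ℤ₃` exists and Hsieh's proof runs over `𝓦 = W(𝔽̄₃)[λ-values] = R₀` [arXiv:1112.1580
p. 21 l. 30, p. 25 ll. 7–13] — (t1) implicit in the CONSTRUCTION (no numbered statement carries the
ring: Thm. 1 / Prop. 5.5 / Thm. 5.6 print `Z̄_p` [p. 3 l. 28, p. 23 l. 40, ll. 56–66]), (t2) `Ω_p ∈ R₀ˣ`
in print [de Shalit 1987, II.4.11 Remark (iii), p. 66; Castella–Hsieh 2018 §2.5], (t3)
`C(π,λ) = ∏` local ε-factors outside `p` [p. 4 l. 18]; (B) `k ≥ 1` (e.g. `ℚ(√−23)`): every admissible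
`λ` and every `χ` of the range has ramified values; road = σ-NATURALITY of `𝒫_Σ(π,λ)` in `λ` under
`Aut(ℂ₃/ℚ̂₃^{ur})` (toric Fourier coefficients §4, `q`-expansion principle, Serre–Tate expansions over
`𝓦`: Prop. 3.15 [p. 16 ll. 57–60], Prop. 5.3 [p. 22 ll. 86–100]) + the PRINTED twist-compatibility
`𝒫_Σ(π,λε) = Tw_ε 𝒫_Σ(π,λ)` (Prop. 5.5 [p. 23 ll. 40–63]) + Ax–Sen–Tate ⇒ `σ(X) = X`, `X ∈ R₀⟦Γ⁻⟧` with
NO re-normalisation constant — UNPRINTED as a statement at `3 ∣ N`. Both roads are insensitive to `λ`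
tame/wild AT `3` (ref H41: this clause is λ-free; the glue feeds the SUPPLIED `λ` to the fact only).
[cite: Hsieh2014, Thm. 1 (arXiv:1112.1580 pp. 3–4) (frame of the antecedent; the R₀-descent at 3 ∣ N is NOT in print)]
[cite: deShalit1987, II.4.11 Remark (iii) (p. 66) ((t2): Ω_p may be taken a unit of the completion of ℚ_p^ur)]
[cite: CastellaHsieh2018, Def. 3.5 and Prop. 3.6 (arXiv:1505.08165 pp. 10–11) (shape of the consequent, printed for p ∤ N)] -/
@[conjecture]
def HsiehDescentAt₃ : Prop :=
  ∀ (ι' : PadicAlgCl 3 ≃+* ℂ) (K : Type) [Field K] [NumberField K]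
    (𝔭 : HeightOneSpectrum (𝓞 K)) (κ : ZpExtension K 3) (γ : Field.absoluteGaloisGroup K)
    {N : ℕ} [NeZero N] {f : CuspForm (CongruenceSubgroup.Gamma0 N) 2}, IsNewformOf W f →
    ClassX11b W 3 → Surj W 3 → W.conductorNorm ℤ = N → IsImaginaryQuadratic K →
    Odd (NumberField.discr K) → SatisfiesHeegnerHypothesis N K →
    ((Ideal.span {(3 : ℤ)}).primesOver (𝓞 K)).ncard = 2 → ((3 : ℕ) : 𝓞 K) ∈ 𝔭.asIdeal →
    𝔭.asIdeal.ramificationIdx (𝓞 ℚ) = 1 → 𝔭.asIdeal.inertiaDeg (𝓞 ℚ) = 1 →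
    (∀ (w : InfinitePlace K) (k : 𝓞 K), k ∈ 𝔭.asIdeal ↔ ‖ι'.symm (w.embedding (k : K))‖ < 1) →
    (∀ ℓ : ℕ, ℓ.Prime → ℓ ∣ N → ∃ v : HeightOneSpectrum (𝓞 K), Ideal.absNorm v.asIdeal = ℓ) →
    κ.IsAnticyclotomic → κ.IsTopGenerator γ →
    ∀ (A : ℝ) (ΩK C : ℂ) (Ωp : ℂ_[3]) (Q : PowerSeries (PadicComplexInt 3)),
      0 < A → ΩK ≠ 0 → ‖((ι'.symm C : PadicAlgCl 3) : ℂ_[3])‖ = 1 → ‖Ωp‖ = 1 →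
      IsHsiehLFunction ι' 𝔭 κ γ f A ΩK C Ωp Q →
      ∃ (ΩK' : ℂ) (Ωp' : (unrIntegers 3)ˣ) (L : UnrSeries 3), ΩK' ≠ 0 ∧
        ∀ (χ : HeckeCharacter K) (n : ℕ), 0 < n →
          (∀ v : HeightOneSpectrum (𝓞 K), χ.IsUnramifiedAt v) →
          χ.HasInfinityType (fun _ ↦ (n : ℤ)) (fun _ ↦ -(n : ℤ)) →
          ∀ r : FramedGaloisRep K (PadicAlgCl 3) 1, IsPAdicAvatarOf ι' χ r → FactorsThroughZp κ r →
            L.HasValueAt (avatarValueAt r γ - 1)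
              (((ι'.symm (hsiehInterpolationValue 3 f 𝔭 χ n A ΩK' 1) : PadicAlgCl 3) : ℂ_[3]) *
                ((Ωp' : unrIntegers 3) : ℂ_[3]) ^ (4 * n))

end Residual

/-! ### S24-c: the split glue and the consumer corollaries -/

section Glue

variable (W : WeierstrassCurve ℚ) [W.IsElliptic] [W.IsGloballyMinimal]

omit [W.IsElliptic] [W.IsGloballyMinimal] in
/-- **S24-c: `(λ-supply at 3) ∧ HsiehDescentAt₃ W ⟹ HsiehFrameResidualAt₃ W`.** The λ-supply
hypothesis `hsup` is the statement of S24-a `Three.lambdaSupplyAt₃` VERBATIM — for every `ι' : ℚ̄₃ ≃ ℂ`,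
every imaginary quadratic `K` in which `3` splits and every anticyclotomic `ℤ₃`-extension `κ` there is
a unitary Hecke character `λ` of infinity type `(1,−1)`, trivial on `𝔸_ℚ^×`, unramified outside `3`, with
a `3`-adic avatar `r_λ` factoring through `κ` (a theorem of class field theory: de Shalit 1987 II.1.4
(ii) + Weil 1956 + Cornut–Vatsal 2007 Cor. 2.2 + CFT; lit1 L58; in the tree it is S24-a, to be
discharged by name — until then it is a HYPOTHESIS, no `def`) —; the residual supplies the `R₀`-frame.
Two lines. [cite: Castella2018, p. 9 l. 42 (arXiv:1704.06608) ("an anticyclotomic Hecke character ψ of infinity type (1,−1)")]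
[cite: deShalit1987, II.1.4 Lemma (ii) (p. 35)] -/
theorem hsiehFrameResidualAt₃_of_descent
    (hsup : ∀ (ι' : PadicAlgCl 3 ≃+* ℂ) (K : Type) [Field K] [NumberField K] (κ : ZpExtension K 3),
      IsImaginaryQuadratic K → ((Ideal.span {(3 : ℤ)}).primesOver (𝓞 K)).ncard = 2 →
      κ.IsAnticyclotomic →
      ∃ (lam : HeckeCharacter K) (rlam : FramedGaloisRep K (PadicAlgCl 3) 1),
        lam.IsUnitary ∧ lam.HasInfinityType (fun _ ↦ (1 : ℤ)) (fun _ ↦ (-1 : ℤ)) ∧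
        (∀ x : ideleGroup ℚ, lam (AdeleRing.ideleBaseChange ℚ K x) = 1) ∧
        (∀ v : HeightOneSpectrum (𝓞 K), ((3 : ℕ) : 𝓞 K) ∉ v.asIdeal → lam.IsUnramifiedAt v) ∧
        IsPAdicAvatarOf ι' lam rlam ∧ FactorsThroughZp κ rlam)
    (hdesc : HsiehDescentAt₃ W) : HsiehFrameResidualAt₃ W := by
  intro ι' K _ _ 𝔭 κ γ N _ f hnf hX hsurj hN hK hodd hHeeg h3 h𝔭 he hf hι' hHeegC hκ hγ
  obtain ⟨lam, rlam, hunit, hinf, hAQ, hunr, hav, hfac⟩ := hsup ι' K κ hK h3 hκ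
  exact ⟨lam, rlam, hunit, hinf, hAQ, hunr, hav, hfac, fun A ΩK C Ωp Q hA hΩK hC hΩp hQ =>
    hdesc ι' K 𝔭 κ γ hnf hX hsurj hN hK hodd hHeeg h3 h𝔭 he hf hι' hHeegC hκ hγ A ΩK C Ωp Q hA hΩK hC hΩp
      hQ⟩

omit [W.IsElliptic] [W.IsGloballyMinimal] in
/-- **The split is LOSSLESS**: `HsiehFrameResidualAt₃ W ⟹ HsiehDescentAt₃ W` outright (drop the
supplied `(λ, r_λ)`; the descent clause does not mention them — `IsHsiehLFunction` is λ-free). Hence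
`HsiehDescentAt₃` is EXACTLY the residual's non-λ content. Nothing asserted.
[cite: Hsieh2014, Thm. 1 (arXiv:1112.1580 pp. 3–4)] -/
theorem hsiehDescentAt₃_of_hsiehFrameResidualAt₃ (hres : HsiehFrameResidualAt₃ W) :
    HsiehDescentAt₃ W := by
  intro ι' K _ _ 𝔭 κ γ N _ f hnf hX hsurj hN hK hodd hHeeg h3 h𝔭 he hf hι' hHeegC hκ hγ
  obtain ⟨-, -, -, -, -, -, -, -, hR⟩ :=
    hres ι' K 𝔭 κ γ hnf hX hsurj hN hK hodd hHeeg h3 h𝔭 he hf hι' hHeegC hκ hγ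
  exact hR

omit [W.IsGloballyMinimal] in
/-- **Calibration (⇐), UNCONDITIONAL: framewise H1 ⟹ `HsiehDescentAt₃ W`.** If at every datum a tree
frame `(Ω_K ≠ 0, Ω_p ∈ R₀ˣ, L ∈ R₀⟦T⟧)` with `IsBDPLFunction` exists (the antecedent of S22's
`bdpExistsAt₃_of_forall_exists_isBDPLFunction`, inlined), then the descent statement holds: the tree
frame realises Hsieh's display with `C = 1` at ANY `A > 0` after `Ω_K' := (16A²/3)^{-1/4}·Ω_K`
(`hsiehDisplay_of_isBDPLFunction`); the Hsieh witness is used only through `0 < A`. So the residual did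
not grow: `HsiehDescentAt₃` is at most as strong as framewise H1. Nothing asserted.
[cite: Castella2018, Thm. 3.1 (arXiv:1704.06608 p. 9) (binder shape only)] -/
theorem hsiehDescentAt₃_of_forall_exists_isBDPLFunction
    (h : ∀ (ι' : PadicAlgCl 3 ≃+* ℂ) (K : Type) [Field K] [NumberField K]
      (𝔭 : HeightOneSpectrum (𝓞 K)) (κ : ZpExtension K 3) (γ : Field.absoluteGaloisGroup K)
      {N : ℕ} [NeZero N] {f : CuspForm (CongruenceSubgroup.Gamma0 N) 2}, IsNewformOf W f →
      ClassX11b W 3 → Surj W 3 → W.conductorNorm ℤ = N → IsImaginaryQuadratic K →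
      Odd (NumberField.discr K) → SatisfiesHeegnerHypothesis N K →
      ((Ideal.span {(3 : ℤ)}).primesOver (𝓞 K)).ncard = 2 → ((3 : ℕ) : 𝓞 K) ∈ 𝔭.asIdeal →
      𝔭.asIdeal.ramificationIdx (𝓞 ℚ) = 1 → 𝔭.asIdeal.inertiaDeg (𝓞 ℚ) = 1 →
      (∀ (w : InfinitePlace K) (k : 𝓞 K), k ∈ 𝔭.asIdeal ↔ ‖ι'.symm (w.embedding (k : K))‖ < 1) →
      (∀ ℓ : ℕ, ℓ.Prime → ℓ ∣ N → ∃ v : HeightOneSpectrum (𝓞 K), Ideal.absNorm v.asIdeal = ℓ) →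
      κ.IsAnticyclotomic → κ.IsTopGenerator γ →
      ∃ (ΩK : ℂ) (Ωp : (unrIntegers 3)ˣ) (L : UnrSeries 3),
        ΩK ≠ 0 ∧ IsBDPLFunction ι' 𝔭 κ γ f ΩK ((Ωp : unrIntegers 3) : ℂ_[3]) L) :
    HsiehDescentAt₃ W := by
  haveI : Fact (Nat.Prime 3) := ⟨Nat.prime_three⟩
  intro ι' K _ _ 𝔭 κ γ N _ f hnf hX hsurj hN hK hodd hHeeg h3 h𝔭 he hf hι' hHeegC hκ hγ A ΩK C Ωp Q
    hA hΩK hC hΩp hQ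
  obtain ⟨ΩK₁, Ωp', L, hΩK₁, hBDP⟩ :=
    h ι' K 𝔭 κ γ hnf hX hsurj hN hK hodd hHeeg h3 h𝔭 he hf hι' hHeegC hκ hγ
  have h3N : 3 ∣ N := hN ▸ dvd_conductorNorm_of_mult hX.2.2.1
  obtain ⟨ΩK', hΩK', hdisp⟩ :=
    hsiehDisplay_of_isBDPLFunction ι' 𝔭 κ γ f h3N hA hΩK₁ ((Ωp' : unrIntegers 3) : ℂ_[3]) L hBDP
  exact ⟨ΩK', Ωp', L, hΩK', hdisp⟩

/-- **H1 from print + λ-supply + descent**: `bdpExistsAt₃_of_hsieh2014` with the S18 residual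
replaced by (λ-supply hypothesis, `HsiehDescentAt₃ W`). CONDITIONAL on the named fact `hH` (Hsieh 2014
Thm. 1, published), on `hsup` (S24-a, a theorem of CFT not yet in the tree) and on the named residual
`hdesc` (NOT in print at `3 ∣ N`); nothing booked; O2 OPEN. [cite: Hsieh2014, Thm. 1 (arXiv:1112.1580 pp. 3–4)] -/
theorem bdpExistsAt₃_of_hsieh2014_of_descent (hH : hsieh2014_exists_anticyclotomicPAdicLFunction)
    (hsup : ∀ (ι' : PadicAlgCl 3 ≃+* ℂ) (K : Type) [Field K] [NumberField K] (κ : ZpExtension K 3),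
      IsImaginaryQuadratic K → ((Ideal.span {(3 : ℤ)}).primesOver (𝓞 K)).ncard = 2 →
      κ.IsAnticyclotomic →
      ∃ (lam : HeckeCharacter K) (rlam : FramedGaloisRep K (PadicAlgCl 3) 1),
        lam.IsUnitary ∧ lam.HasInfinityType (fun _ ↦ (1 : ℤ)) (fun _ ↦ (-1 : ℤ)) ∧
        (∀ x : ideleGroup ℚ, lam (AdeleRing.ideleBaseChange ℚ K x) = 1) ∧
        (∀ v : HeightOneSpectrum (𝓞 K), ((3 : ℕ) : 𝓞 K) ∉ v.asIdeal → lam.IsUnramifiedAt v) ∧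
        IsPAdicAvatarOf ι' lam rlam ∧ FactorsThroughZp κ rlam)
    (hdesc : HsiehDescentAt₃ W) : BDPExistsAt₃ W :=
  bdpExistsAt₃_of_hsieh2014 W hH (hsiehFrameResidualAt₃_of_descent W hsup hdesc)

/-- **`H2 ∧ H3 ⟹ BSD(E,3)` on A1 given Hsieh 2014 Thm. 1, λ-supply and the descent residual**:
`bsdp_of_halves₃_onA1_of_hsieh2014` with `hres` replaced by (`hsup`, `hdesc`). CONDITIONAL on every
listed fact binder, on `hsup` (S24-a), the named residual `hdesc` and the two typed halves; per pair;
nothing booked; no label change; O2 OPEN. [cite: Hsieh2014, Thm. 1 (arXiv:1112.1580 pp. 3–4)]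
[cite: Castella2018, Thm. 2.3 (p. 5), Thm. 3.2 (p. 9), §5 (p. 12)] [cite: JetchevSkinnerWan2017, Thm. 3.3.1 (p. 11)]
[cite: Miller2011LMS, Def. 1.1] -/
theorem bsdp_of_halves₃_onA1_of_hsieh2014_of_descent
    (hGZ : ∀ (N : ℕ) [NeZero N] (W : WeierstrassCurve ℚ) (K : Type) [Field K] [NumberField K],
      gross_zagier N W K)
    (hKo : ∀ (N : ℕ) [NeZero N] (W : WeierstrassCurve ℚ) (K : Type) [Field K] [NumberField K],
      kolyvagin N W K)
    (hB : ∀ (N : ℕ) [NeZero N] (W : WeierstrassCurve ℚ) (K : Type) [Field K] [NumberField K],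
      Kolyvagin1990_padicValNat_card_sha_le N W K)
    (hSk : Skinner2016.thmC_padicValRat_bsd_rank_zero) (hWu : sha_dvd_analyticSha)
    (hGZK : rank_eq_analyticRank_of_analyticRank_le_one) (hmod : hasEntireLFunction_rat)
    (hnf : exists_isNewformOf) (hHL : HoffsteinLuo1997_exists_twist_L_one_ne_zero)
    (hMaz : mazur_not_dvd_maninConstant_of_odd)
    (hPT : ∀ (K : Type) [Field K] [NumberField K], poitouTate_sum_localTatePairing_eq_zero K)
    (hEP : ∀ (K : Type) [Field K] [NumberField K] (v : HeightOneSpectrum (𝓞 K)),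
      localEulerPoincareCharacteristic (v.adicCompletion K))
    (hPTs : ∀ (K : Type) [Field K] [NumberField K], poitouTate_selmerStructure_duality K)
    (hPT2 : ∀ (K : Type) [Field K] [NumberField K], poitouTate_sha_tateDual K)
    (hcd : fieldCdLE_two_of_numberField) (hH : hsieh2014_exists_anticyclotomicPAdicLFunction)
    (hsup : ∀ (ι' : PadicAlgCl 3 ≃+* ℂ) (K : Type) [Field K] [NumberField K] (κ : ZpExtension K 3),
      IsImaginaryQuadratic K → ((Ideal.span {(3 : ℤ)}).primesOver (𝓞 K)).ncard = 2 →
      κ.IsAnticyclotomic →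
      ∃ (lam : HeckeCharacter K) (rlam : FramedGaloisRep K (PadicAlgCl 3) 1),
        lam.IsUnitary ∧ lam.HasInfinityType (fun _ ↦ (1 : ℤ)) (fun _ ↦ (-1 : ℤ)) ∧
        (∀ x : ideleGroup ℚ, lam (AdeleRing.ideleBaseChange ℚ K x) = 1) ∧
        (∀ v : HeightOneSpectrum (𝓞 K), ((3 : ℕ) : 𝓞 K) ∉ v.asIdeal → lam.IsUnramifiedAt v) ∧
        IsPAdicAvatarOf ι' lam rlam ∧ FactorsThroughZp κ rlam)
    (hX : ClassX11b W 3) (hram : Ram W 3) (htam : ¬ 3 ∣ W.tamagawaProduct)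
    (hdesc : HsiehDescentAt₃ W) (h2 : BDPValueAt₃ W) (h3 : IMCDivAt₃ W) : BSDp W 3 :=
  bsdp_of_halves₃_onA1_of_hsieh2014 W hGZ hKo hB hSk hWu hGZK hmod hnf hHL hMaz hPT hEP hPTs hPT2 hcd hH
    hX hram htam (hsiehFrameResidualAt₃_of_descent W hsup hdesc) h2 h3

/-- **Per-pair bookkeeping**: on A1, under Hsieh 2014 Thm. 1, λ-supply, the descent residual, H2, H3
and the listed facts, the CLASS's typed missing input `X11Three.MissingInputAt W` holds at the pair
`(E, 3)` (`missingInputAt_of_halves₃_onA1_of_hsieh2014` with `hres` replaced). The `Prop` about the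
CLASS is NOT made available; nothing booked. [cite: Miller2011LMS, §1 and Def. 1.1 (arXiv:1010.2431 p. 3)] -/
theorem missingInputAt_of_halves₃_onA1_of_hsieh2014_of_descent
    (hGZ : ∀ (N : ℕ) [NeZero N] (W : WeierstrassCurve ℚ) (K : Type) [Field K] [NumberField K],
      gross_zagier N W K)
    (hKo : ∀ (N : ℕ) [NeZero N] (W : WeierstrassCurve ℚ) (K : Type) [Field K] [NumberField K],
      kolyvagin N W K)
    (hB : ∀ (N : ℕ) [NeZero N] (W : WeierstrassCurve ℚ) (K : Type) [Field K] [NumberField K],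
      Kolyvagin1990_padicValNat_card_sha_le N W K)
    (hSk : Skinner2016.thmC_padicValRat_bsd_rank_zero) (hWu : sha_dvd_analyticSha)
    (hGZK : rank_eq_analyticRank_of_analyticRank_le_one) (hmod : hasEntireLFunction_rat)
    (hnf : exists_isNewformOf) (hHL : HoffsteinLuo1997_exists_twist_L_one_ne_zero)
    (hMaz : mazur_not_dvd_maninConstant_of_odd)
    (hPT : ∀ (K : Type) [Field K] [NumberField K], poitouTate_sum_localTatePairing_eq_zero K)
    (hEP : ∀ (K : Type) [Field K] [NumberField K] (v : HeightOneSpectrum (𝓞 K)),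
      localEulerPoincareCharacteristic (v.adicCompletion K))
    (hPTs : ∀ (K : Type) [Field K] [NumberField K], poitouTate_selmerStructure_duality K)
    (hPT2 : ∀ (K : Type) [Field K] [NumberField K], poitouTate_sha_tateDual K)
    (hcd : fieldCdLE_two_of_numberField) (hH : hsieh2014_exists_anticyclotomicPAdicLFunction)
    (hsup : ∀ (ι' : PadicAlgCl 3 ≃+* ℂ) (K : Type) [Field K] [NumberField K] (κ : ZpExtension K 3),
      IsImaginaryQuadratic K → ((Ideal.span {(3 : ℤ)}).primesOver (𝓞 K)).ncard = 2 →
      κ.IsAnticyclotomic →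
      ∃ (lam : HeckeCharacter K) (rlam : FramedGaloisRep K (PadicAlgCl 3) 1),
        lam.IsUnitary ∧ lam.HasInfinityType (fun _ ↦ (1 : ℤ)) (fun _ ↦ (-1 : ℤ)) ∧
        (∀ x : ideleGroup ℚ, lam (AdeleRing.ideleBaseChange ℚ K x) = 1) ∧
        (∀ v : HeightOneSpectrum (𝓞 K), ((3 : ℕ) : 𝓞 K) ∉ v.asIdeal → lam.IsUnramifiedAt v) ∧
        IsPAdicAvatarOf ι' lam rlam ∧ FactorsThroughZp κ rlam)
    (hX : ClassX11b W 3) (hram : Ram W 3) (htam : ¬ 3 ∣ W.tamagawaProduct)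
    (hdesc : HsiehDescentAt₃ W) (h2 : BDPValueAt₃ W) (h3 : IMCDivAt₃ W) :
    X11Three.MissingInputAt W :=
  missingInputAt_of_halves₃_onA1_of_hsieh2014 W hGZ hKo hB hSk hWu hGZK hmod hnf hHL hMaz hPT hEP hPTs
    hPT2 hcd hH hX hram htam (hsiehFrameResidualAt₃_of_descent W hsup hdesc) h2 h3

end Glue

end Summit.BirchSwinnertonDyer.Rank1Residual.X11b.Three

end
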